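import Summits.BirchSwinnertonDyer.BirchSwinnertonDyer.Theorems.KimAtThreeShallowEqDeepWeightedOfKatoV2
import Summits.BirchSwinnertonDyer.BirchSwinnertonDyer.Theorems.KimAtThreeShallowEqDeepTwistedLattice
import Summits.BirchSwinnertonDyer.BirchSwinnertonDyer.Theorems.KimAtThreeSemiLocalTraceDualTwistLocal
import Literature.NumberTheory.EllipticCurves.LFunctionPrimeCoeff
import HarnessLib

/-!
# Route `KimAtThreeKolyvagin` (W2): the defined-Kato package with the TWISTED (Euler-factor) compatibility (C1ₑₓ^τ) of the
# good ANOMALOUS `t = 0` rows FROM the Kato-v2 statement hKatoV2ʷ and the cite facts (S5a), (S5b-tower) — the twisted twin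
# of gen 11's `KimAtThreeShallowEqDeepWeightedOfKatoV2` (items 20397 · 19599 · 19077; cell `bsd-addord`, seat w2-c4 gen 12;
# `--supports` 19077, helper)

HONEST FRAMING.  TOOL theorem (no definition, no instance attribute, no `sorry`); hKatoV2ʷ is DISPLAYED (= w2-c2 g9's hKatoV2ᵘ
text VERBATIM with kim3's R-κ clause, exactly gen 11's binder); (S5a) / (S5b-tower) are cite-only named facts carried as
hypotheses; nothing is closed or booked; BSD is not proved by any of this.
**`definedKatoTwist_of_katoV2_of_facts : (S5a) → (S5b-tower) → hKatoV2ʷ → ∀ good-anomalous t = 0 row, (C1ₑₓ^τ)`** (gen 10's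
DEFKATOτ of `KimAtThreeShallowEqDeepGoodOfDefinedKato`, VERBATIM).  Proof = gen 11's `definedKatoWeighted_of_katoV2_of_facts` with the
weighted compatibility replaced by the TWISTED one: COMPAT_τ quantifies over `w ∈ (ℤ/m)ˣ` with `w·[3] = 1`, so it is VACUOUS at
the wild levels (`3 ∣ m`) and at a tame level `m = cycLevel 3 0 r` the per-factor input is this seat's twisted lattice bound
`3 · exp*_{dw}(z) ∈ P_w^loc·𝒪_{w₀}` (`KimAtThreeShallowEqDeepTwistedLattice.exists_prime_mul_expStarOmegaHom_eq_eulerTwistLoc_of_facts`: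
(S5b-tower) ∘ the kport / w2-acc3 lattice lemma on the good-anomalous row ∘ w2-acc3's duality `(E_p(φ)⁻¹𝒪)^∨ = E_p(φ⁻¹)𝒪`),
transported along `S_w = (g̃_w⁻¹)_*` (which commutes with `(σ_w)_*`: `Gal(ℚ(ζ_m)/ℚ)` is abelian) and assembled under w2-acc4's
`Ψ` by w2-acc3's `padicTensor_eulerTwist_apply` (`Ψ(Tw_{P_w} l)_𝔓 = P_w^loc (Ψ l)_𝔓`).  With gen 10's `fineKatoτ_of_definedKatoTwist` and
gen 9's `KimAtThreeShallowEqDeepAnomalousRows`: the good-ANOMALOUS `t = 0` rows of 19599 / 19077 (item 20397) ⟸ «leaves ∧ (S5a) ∧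
(S5b-tower) ∧ hKatoV2ʷ» — the SAME displayed Kato-side statement as the deep family and the non-anomalous rows (sibling
`KimAtThreeShallowEqDeepTwistedItemOfKatoV2`).
References: [Kato2004Asterisque] (8.1.3), §9.4, Thm. 9.7, Ex. 13.3; [Kato1993LNM1553] II Thm. 1.4.1; [BlochKato1990] §3
Prop. 3.8, Ex. 3.11; [Kim2022StructureSelmer] Lemma 3.4, Cor. 3.5, Thm. 3.13; [CasselsFrohlichANT1967] II §10, VII §1.1;
memos HOME/w2c4/W2C4-ANOMALOUS-PORT-g9.md §2, W2C4-WEIGHTED-COMPAT-g11.md.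
-/

set_option autoImplicit false

noncomputable section

-- the cell's Theorems namespace `Summit.BirchSwinnertonDyer.BirchSwinnertonDyer.…` repeats the summit name by design (D-0017)
set_option linter.dupNamespace false

open scoped Classical NumberField TensorProduct ContRepresentation Pointwise
open Field ValuativeRel Function IsDedekindDomain NumberField
open WeierstrassCurve Literature.NumberTheory.EllipticCurves Literature.NumberTheory.GaloisRepresentations
  Literature.NumberTheory.GaloisRepresentations.DiscreteGaloisModule Literature.NumberTheory.GaloisCohomology
open Literature.NumberTheory.GaloisRepresentations.PeriodRingData Literature.NumberTheory.PAdicHodge Literature.NumberTheory.EllipticCurves.ModularForms Literature.NumberTheory.EllipticCurves.Rank1Residual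
open Literature.NumberTheory.EllipticCurves.Kato2004 Literature.NumberTheory.EllipticCurves.Kato2004.EulerSystemValues
open Literature.NumberTheory.AdelicBaseChange Literature.NumberTheory.Automorphic
open Summit.BirchSwinnertonDyer.Rank1Residual.GaloisImage Summit.BirchSwinnertonDyer.Rank1Residual.Additive.LocalLog
open Summit.BirchSwinnertonDyer.BirchSwinnertonDyer.Theorems
open Summit.BirchSwinnertonDyer.BirchSwinnertonDyer.Theorems.KimAtThreeFineKatoLevelCompat
open Summit.BirchSwinnertonDyer.BirchSwinnertonDyer.Theorems.KimAtThreeFineKatoPerFactorDefined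
open Summit.BirchSwinnertonDyer.BirchSwinnertonDyer.Theorems.KimAtThreeFineKatoPerFactorDefinedTwist
open Summit.BirchSwinnertonDyer.BirchSwinnertonDyer.Theorems.KimAtThreeDeepLowerExpStarOmega
open Summit.BirchSwinnertonDyer.BirchSwinnertonDyer.Theorems.KimAtThreeDeepLowerExpStarOmegaPlace
open Summit.BirchSwinnertonDyer.BirchSwinnertonDyer.Theorems.KimAtThreeFineKatoPerFactorPlaces
open Summit.BirchSwinnertonDyer.BirchSwinnertonDyer.Theorems.KimAtThreeDeepUpperExpStarFacts
open Summit.BirchSwinnertonDyer.Rank1Residual.GaloisImage.TameLevel (squarefree_cycLevel_zero)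
open Summit.BirchSwinnertonDyer.BirchSwinnertonDyer.Theorems.KimAtThreeSemiLocalTraceDualCyc
open Summit.BirchSwinnertonDyer.BirchSwinnertonDyer.Theorems.KimAtThreeShallowEqDeepTraceDualLattice
open Summit.BirchSwinnertonDyer.BirchSwinnertonDyer.Theorems.KimAtThreeShallowEqDeepWildDifferentLocal
open Summit.BirchSwinnertonDyer.BirchSwinnertonDyer.Theorems.KimAtThreeShallowEqDeepRiderOfWeightedCompat
open Summit.BirchSwinnertonDyer.BirchSwinnertonDyer.Theorems.KimAtThreeShallowEqDeepWeightedOfKatoV2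
open Summit.BirchSwinnertonDyer.BirchSwinnertonDyer.Theorems.KimAtThreeShallowEqDeepTwistedLattice
open Summit.BirchSwinnertonDyer.BirchSwinnertonDyer.Theorems.KimAtThreeSemiLocalTraceDualTwistLocal

namespace Summit.BirchSwinnertonDyer.BirchSwinnertonDyer.Theorems.KimAtThreeShallowEqDeepTwistedOfKatoV2

/-- Local notation: Kato's `ZetaBody` FAMILY for `(ι, κK, Λ)` and the cusp form `f'` at level `N'`. -/
local notation3 (prettyPrint := false) "ZBODY⟦" W' ", " N' ", " f' ", " ι' ", " κ' ", " Λ' "⟧" =>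
  ∀ (c d a : ℤ) (A : ℕ), 0 < A → Int.gcd c (6 * 3 * A) = 1 → Int.gcd d (6 * 3 * N') = 1 →
    ∃ (z : ∀ (k' : ℕ) (r : (cyclotomicLevelsRat 3 (badPlaces c d A N')).Ideals),
          H1 (tateRep W' 3) ((cyclotomicLevelsRat 3 (badPlaces c d A N')).level k' r.1))
      (x : ∀ (k' : ℕ) (r : (cyclotomicLevelsRat 3 (badPlaces c d A N')).Ideals),
          CyclotomicField (cycLevel 3 k' r.1) ℚ),
      ZetaBody W' 3 f' ι' κ' Λ' c d a A z x

/-- Local notation: the TWISTED compatibility COMPAT_τ at depth `j` between `Λ_{0,r}` and `φ` (place `v`, model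
`t₃`): «`3•(φ(h) ⊗ 1 − Λ_{0,r}(y)) ∈ 3^{j+1}·Tw_{P_w} L_int`» for every `T`-lift `h` of `loc_v κ₀`, `res κ₀ = Ψ y`,
and every `w` with `w·[3] = 1`. -/
local notation3 (prettyPrint := false) "COMPATτ⟦" W' ", " j ", " v' ", " t3 ", " Λ' ", " φ0 "⟧" =>
  ∀ (r : Finset (HeightOneSpectrum (𝓞 ℚ))) (w : (ZMod (cycLevel 3 0 r))ˣ),
    (w : ZMod (cycLevel 3 0 r)) * ((3 : ℕ) : ZMod (cycLevel 3 0 r)) = 1 →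
    ∀ (Ψ : H1 (tateRep W' 3) (cycSubgroup 3 0 r) →+
      continuousCohomology 1 (subgroupRep
        (WeierstrassCurve.torsionGaloisModule W' (((3 : ℕ) : ℤ) ^ j * ((3 : ℕ) : ℤ))).toTopRep (cycSubgroup 3 0 r))),
    (∀ (φ₁ : contOneCocycles (subgroupRep (tateRep W' 3).toTopRep (cycSubgroup 3 0 r)))
        (ψ : contOneCocycles (subgroupRep
          (WeierstrassCurve.torsionGaloisModule W' (((3 : ℕ) : ℤ) ^ j * ((3 : ℕ) : ℤ))).toTopRep (cycSubgroup 3 0 r))),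
        (∀ g, ((ψ.1 g : geomTorsion W' (((3 : ℕ) : ℤ) ^ j * ((3 : ℕ) : ℤ))) : geomPoints W') =
          TateModule.proj 3 (j + 1) (φ₁.1 g)) →
        Ψ (oneCocycleClass _ φ₁) = oneCocycleClass _ ψ) →
    ∀ (y : H1 (tateRep W' 3) (cycSubgroup 3 0 r))
      (κ₀ : galoisCohomology (WeierstrassCurve.torsionGaloisModule W' (((3 : ℕ) : ℤ) ^ j * ((3 : ℕ) : ℤ))) 1)
      (h : (tateLocalRep W' 3 (Sum.inr v')).cohomology 1),
      resSubgroup (WeierstrassCurve.torsionGaloisModule W' (((3 : ℕ) : ℤ) ^ j * ((3 : ℕ) : ℤ))).toTopRep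
          (cycSubgroup 3 0 r) 1 κ₀ = Ψ y →
      galoisCohomology.localization (WeierstrassCurve.torsionGaloisModule W' (((3 : ℕ) : ℤ) ^ j * ((3 : ℕ) : ℤ)))
          (Sum.inr v') 1 κ₀ = tateLocalMap W' 3 j (Sum.inr v') h →
      ∃ l ∈ cycIntLattice 3 (cycLevel 3 0 r),
        ((3 : ℕ) : ℤ_[3]) • ((φ0 h ⊗ₜ[ℚ] (1 : CyclotomicField (cycLevel 3 0 r) ℚ)) - Λ' 0 r y) =
          ((3 : ℤ_[3]) ^ (j + 1)) • ∑ g : (ZMod (cycLevel 3 0 r))ˣ,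
            ((((((3 : ℕ) : MonoidAlgebra ℤ_[3] (ZMod (cycLevel 3 0 r))ˣ)) -
                MonoidAlgebra.single w (t3 : ℤ_[3]) +
                MonoidAlgebra.single (w ^ 2) (1 : ℤ_[3])).coeff g : ℤ_[3]) : ℚ_[3]) •
              Algebra.TensorProduct.map (AlgHom.id ℚ ℚ_[3])
                (sigma (cycLevel 3 0 r) g : CyclotomicField (cycLevel 3 0 r) ℚ →ₐ[ℚ]
                  CyclotomicField (cycLevel 3 0 r) ℚ) l

/-- Local notation: **(C1ₑₓ^τ) at the row `(W, v, P)` with integer model `t₃` of `a₃`** — the DEFINED-KATO package with the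
TWISTED (Euler-factor) compatibility: `(ι, κK, Λ, φ)` with `κK ≠ 0` a rational `3`-adic unit, `hker`, `hdual`, COMPAT_τ at
every depth, and Kato's `ZetaBody` family for `P.f`. -/
local notation3 (prettyPrint := false) "DEFKATOτ⟦" W' ", " v' ", " N' ", " P' ", " t3 "⟧" =>
  ∃ (ι : (n : ℕ) → (CyclotomicField n ℚ →+* ℂ)) (κK : ℝ)
    (Λ : ∀ (k' : ℕ) (r : Finset (HeightOneSpectrum (𝓞 ℚ))),
      H1 (tateRep W' 3) (cycSubgroup 3 k' r) →ₗ[ℤ_[3]] ℚ_[3] ⊗[ℚ] CyclotomicField (cycLevel 3 k' r) ℚ)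
    (φ : (tateLocalRep W' 3 (Sum.inr v')).cohomology 1 →+ ℚ_[3]),
    κK ≠ 0 ∧ (∃ u : ℚ, (u : ℝ) = κK ∧ padicValRat 3 u = 0) ∧
    (∀ y, φ y = 0 ↔ ∀ j : ℕ, tateLocalMap W' 3 j (Sum.inr v') y ∈
      WeierstrassCurve.kummerSelmerStructure W' (((3 : ℕ) : ℤ) ^ j * ((3 : ℕ) : ℤ)) (Sum.inr v')) ∧
    (∀ a : ℚ_[3], (∃ y, φ y = a) ↔
      ∀ Q : ((W' : WeierstrassCurve ℚ).baseChange ℚ_[3]).toAffine.Point,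
        ‖a * padicLog ((W' : WeierstrassCurve ℚ).baseChange ℚ_[3]) Q‖ ≤ 1) ∧
    (∀ j : ℕ, COMPATτ⟦W', j, v', t3, Λ, φ⟧) ∧
    ZBODY⟦W', N', (P' : ModularParametrizationData W' N').f, ι, κK, Λ⟧

/-- `σ_a` and `σ_b` commute (`Gal(ℚ(ζ_m)/ℚ) ≅ (ℤ/m)ˣ` is abelian; `sigma m` is a group isomorphism). [folklore] -/
theorem commute_sigma (m : ℕ) [NeZero m] (a b : (ZMod m)ˣ) : Commute (sigma m a) (sigma m b) := by
  show sigma m a * sigma m b = sigma m b * sigma m a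
  unfold sigma
  rw [← map_mul, ← map_mul, mul_comm]

set_option backward.isDefEq.respectTransparency false in
set_option maxHeartbeats 800000 in
/-- **(C1ₑₓ^τ) from (S5a), (S5b-tower) and hKatoV2ʷ** on every `3`-adic-tower row with GOOD ANOMALOUS reduction at `3`
(`3 ∣ 3 + 1 − a₃`), `#E(ℚ₃)[3] = 1`, and a lattice-optimal parametrisation at the conductor (integer model `t₃` of `a₃(P.f)`).
[cite: Kato2004Asterisque, §9.4 (p. 188), Thm. 9.7 (p. 189) and Ex. 13.3 (pp. 224–225)] [cite: BlochKato1990, §3 Prop. 3.8, Ex. 3.11]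
[cite: Kim2022StructureSelmer, Lemma 3.4, Cor. 3.5 and the proof of Thm. 3.13] [cite: CasselsFrohlichANT1967, Ch. II §10 Theorem (10.2) and §11, Ch. VII §1.1] -/
theorem definedKatoTwist_of_katoV2_of_facts (hS : expStarCoord_eq_zero_iff_kummer)
    (hT₂ : exists_smul_range_expStarCoord_tower_iff_trace_log)
    (hKatoV2 : ∀ (W : WeierstrassCurve ℚ) [W.IsElliptic] [W.IsGloballyMinimal]
      [ContinuousSMul ℤ_[3] (W.tateModule 3)] [Module.Free ℤ_[3] (W.tateModule 3)]
      [Module.Finite ℤ_[3] (W.tateModule 3)],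
      (∀ m : ℕ, W.HasSurjectiveModNGaloisRep (3 ^ m : ℕ)) →
      ∀ {N : ℕ} [NeZero N] (P : ModularParametrizationData W N), N = W.conductorNorm ℤ →
        (∀ z ∈ P.L.lattice, ∃ w ∈ periodLattice P.f, z = P.c * w) →
        haveI : Fact (((3 : ℕ) : 𝓞 ℚ) ∈ ((Rat.HeightOneSpectrum.primesEquiv (R := 𝓞 ℚ)).symm ⟨3, Fact.out⟩).asIdeal) :=
          ⟨(natCast_mem_asIdeal_iff_eq_primesEquiv_symm _ Nat.prime_three).mpr rfl⟩
        letI := valuativeRelPlace ((Rat.HeightOneSpectrum.primesEquiv (R := 𝓞 ℚ)).symm ⟨3, Fact.out⟩)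
        letI := topologicalSpacePlace ((Rat.HeightOneSpectrum.primesEquiv (R := 𝓞 ℚ)).symm ⟨3, Fact.out⟩)
        haveI := isNonarchimedeanLocalField_place ((Rat.HeightOneSpectrum.primesEquiv (R := 𝓞 ℚ)).symm ⟨3, Fact.out⟩)
        haveI := charZero_place ((Rat.HeightOneSpectrum.primesEquiv (R := 𝓞 ℚ)).symm ⟨3, Fact.out⟩)
        letI := padicAlgebraPlace 3 ((Rat.HeightOneSpectrum.primesEquiv (R := 𝓞 ℚ)).symm ⟨3, Fact.out⟩)
        haveI := fact_not_isUnit_place 3 ((Rat.HeightOneSpectrum.primesEquiv (R := 𝓞 ℚ)).symm ⟨3, Fact.out⟩)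
        haveI := isAdicComplete_place 3 ((Rat.HeightOneSpectrum.primesEquiv (R := 𝓞 ℚ)).symm ⟨3, Fact.out⟩)
        ∃ (d : LocalNeronLineAt W 3 ((Rat.HeightOneSpectrum.primesEquiv (R := 𝓞 ℚ)).symm ⟨3, Fact.out⟩))
          (hinj : (bdRPeriodRingData (valuation_place_lt_one 3 ((Rat.HeightOneSpectrum.primesEquiv (R := 𝓞 ℚ)).symm ⟨3, Fact.out⟩))).CupLogInjective (logCyclotomic 3)
            (localRationalTateRep W 3 (galRestrictPlace ((Rat.HeightOneSpectrum.primesEquiv (R := 𝓞 ℚ)).symm ⟨3, Fact.out⟩))))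
          (hex : ∀ z : contOneCocycles (localRationalTateRep W 3 (galRestrictPlace ((Rat.HeightOneSpectrum.primesEquiv (R := 𝓞 ℚ)).symm ⟨3, Fact.out⟩))).toTopRep,
            (bdRPeriodRingData (valuation_place_lt_one 3 ((Rat.HeightOneSpectrum.primesEquiv (R := 𝓞 ℚ)).symm ⟨3, Fact.out⟩))).HasDualExp (logCyclotomic 3)
              (localRationalTateRep W 3 (galRestrictPlace ((Rat.HeightOneSpectrum.primesEquiv (R := 𝓞 ℚ)).symm ⟨3, Fact.out⟩))) fun σ => z.1 σ),
          (∀ a : ℚ_[3], (∃ y, (expStarOmegaPadicAt d hinj hex (((Padic.adicCompletionEquiv (𝓞 ℚ) ⟨3, Fact.out⟩).symm : (((Rat.HeightOneSpectrum.primesEquiv (R := 𝓞 ℚ)).symm ⟨3, Fact.out⟩).adicCompletion ℚ) →+* ℚ_[3]))) y = a) ↔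
            ∀ Q : (W.baseChange ℚ_[3]).toAffine.Point, ‖a * padicLog (W.baseChange ℚ_[3]) Q‖ ≤ 1) ∧
        ∃ (ι : (n : ℕ) → (CyclotomicField n ℚ →+* ℂ)) (κK : ℝ)
          (Λ : ∀ (k' : ℕ) (r : Finset (HeightOneSpectrum (𝓞 ℚ))),
            H1 (tateRep W 3) (cycSubgroup 3 k' r) →ₗ[ℤ_[3]]
              ℚ_[3] ⊗[ℚ] CyclotomicField (cycLevel 3 k' r) ℚ),
          κK ≠ 0 ∧ (∃ u : ℚ, (u : ℝ) = κK ∧ padicValRat 3 u = 0) ∧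
          (∀ (j : ℕ) (r : Finset (HeightOneSpectrum (𝓞 ℚ)))
            (Ψ : ℚ_[3] ⊗[ℚ] CyclotomicField (cycLevel 3 0 r) ℚ ≃ₐ[ℚ]
              (Π w : ((Rat.HeightOneSpectrum.primesEquiv (R := 𝓞 ℚ)).symm ⟨3, Fact.out⟩).Extension
                (𝓞 (CyclotomicField (cycLevel 3 0 r) ℚ)), w.1.adicCompletion (CyclotomicField (cycLevel 3 0 r) ℚ)))
            (hΨ : ∀ (s : ℚ_[3]) (x : CyclotomicField (cycLevel 3 0 r) ℚ)
              (w : ((Rat.HeightOneSpectrum.primesEquiv (R := 𝓞 ℚ)).symm ⟨3, Fact.out⟩).Extension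
                (𝓞 (CyclotomicField (cycLevel 3 0 r) ℚ))),
              Ψ (s ⊗ₜ[ℚ] x) w =
                algebraMap (CyclotomicField (cycLevel 3 0 r) ℚ) (w.1.adicCompletion (CyclotomicField (cycLevel 3 0 r) ℚ)) x *
                algebraMap (((Rat.HeightOneSpectrum.primesEquiv (R := 𝓞 ℚ)).symm ⟨3, Fact.out⟩).adicCompletion ℚ)
                  (w.1.adicCompletion (CyclotomicField (cycLevel 3 0 r) ℚ)) ((Padic.adicCompletionEquiv (𝓞 ℚ) ⟨3, Fact.out⟩) s)),
            ∃ (w₀ : ((Rat.HeightOneSpectrum.primesEquiv (R := 𝓞 ℚ)).symm ⟨3, Fact.out⟩).Extension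
                (𝓞 (CyclotomicField (cycLevel 3 0 r) ℚ)))
              (g : ((Rat.HeightOneSpectrum.primesEquiv (R := 𝓞 ℚ)).symm ⟨3, Fact.out⟩).Extension
                (𝓞 (CyclotomicField (cycLevel 3 0 r) ℚ)) → absoluteGaloisGroup ℚ)
              (hg : ∀ w : ((Rat.HeightOneSpectrum.primesEquiv (R := 𝓞 ℚ)).symm ⟨3, Fact.out⟩).Extension
                (𝓞 (CyclotomicField (cycLevel 3 0 r) ℚ)),
                sigma (cycLevel 3 0 r) (modNCyclotomicCharacter ℚ (cycLevel 3 0 r) (g w)) • w.1 = w₀.1),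
                letI := LocalField.charZero_adicCompletion w₀.1
                letI := LocalField.adicCompletionPadicAlgebra w₀.1 3 (three_mem_asIdeal_extension _ w₀)
                haveI : Fact (¬ IsUnit ((3 : ℕ) : integerC (w₀.1.adicCompletion (CyclotomicField (cycLevel 3 0 r) ℚ)))) :=
                  ⟨not_isUnit_natCast_integerC (LocalField.valuation_adicCompletion_natCast_lt_one w₀.1 3 (three_mem_asIdeal_extension _ w₀))⟩
                haveI := isAdicComplete_integerC_natCast (LocalField.valuation_adicCompletion_natCast_lt_one w₀.1 3 (three_mem_asIdeal_extension _ w₀))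
                ∃ (dw : LocalNeronLine W (LocalField.valuation_adicCompletion_natCast_lt_one w₀.1 3 (three_mem_asIdeal_extension _ w₀))
                  ((galRestrictPlace ((Rat.HeightOneSpectrum.primesEquiv (R := 𝓞 ℚ)).symm ⟨3, Fact.out⟩)).comp
                    (absGaloisRestrict (((Rat.HeightOneSpectrum.primesEquiv (R := 𝓞 ℚ)).symm ⟨3, Fact.out⟩).adicCompletion ℚ) (w₀.1.adicCompletion (CyclotomicField (cycLevel 3 0 r) ℚ)))))
                  (hinjw : (bdRPeriodRingData (LocalField.valuation_adicCompletion_natCast_lt_one w₀.1 3 (three_mem_asIdeal_extension _ w₀))).CupLogInjective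
                  (logCyclotomic 3) (localRationalTateRep W 3 ((galRestrictPlace ((Rat.HeightOneSpectrum.primesEquiv (R := 𝓞 ℚ)).symm ⟨3, Fact.out⟩)).comp
                    (absGaloisRestrict (((Rat.HeightOneSpectrum.primesEquiv (R := 𝓞 ℚ)).symm ⟨3, Fact.out⟩).adicCompletion ℚ) (w₀.1.adicCompletion (CyclotomicField (cycLevel 3 0 r) ℚ))))))
                  (hexw : ∀ z : contOneCocycles (localRationalTateRep W 3 ((galRestrictPlace ((Rat.HeightOneSpectrum.primesEquiv (R := 𝓞 ℚ)).symm ⟨3, Fact.out⟩)).comp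
                    (absGaloisRestrict (((Rat.HeightOneSpectrum.primesEquiv (R := 𝓞 ℚ)).symm ⟨3, Fact.out⟩).adicCompletion ℚ) (w₀.1.adicCompletion (CyclotomicField (cycLevel 3 0 r) ℚ))))).toTopRep,
                  (bdRPeriodRingData (LocalField.valuation_adicCompletion_natCast_lt_one w₀.1 3 (three_mem_asIdeal_extension _ w₀))).HasDualExp
                    (logCyclotomic 3) (localRationalTateRep W 3 ((galRestrictPlace ((Rat.HeightOneSpectrum.primesEquiv (R := 𝓞 ℚ)).symm ⟨3, Fact.out⟩)).comp
                    (absGaloisRestrict (((Rat.HeightOneSpectrum.primesEquiv (R := 𝓞 ℚ)).symm ⟨3, Fact.out⟩).adicCompletion ℚ) (w₀.1.adicCompletion (CyclotomicField (cycLevel 3 0 r) ℚ))))) fun σ => z.1 σ),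
                  (∀ (h : (tateLocalRep W 3 (Sum.inr ((Rat.HeightOneSpectrum.primesEquiv (R := 𝓞 ℚ)).symm ⟨3, Fact.out⟩))).cohomology 1),
                  (expStarOmegaHom (LocalField.valuation_adicCompletion_natCast_lt_one w₀.1 3 (three_mem_asIdeal_extension _ w₀))
                    ((galRestrictPlace ((Rat.HeightOneSpectrum.primesEquiv (R := 𝓞 ℚ)).symm ⟨3, Fact.out⟩)).comp
                    (absGaloisRestrict (((Rat.HeightOneSpectrum.primesEquiv (R := 𝓞 ℚ)).symm ⟨3, Fact.out⟩).adicCompletion ℚ) (w₀.1.adicCompletion (CyclotomicField (cycLevel 3 0 r) ℚ)))) dw hinjw hexw)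
                    (ContinuousRep.cohomologyRes (tateLocalRep W 3 (Sum.inr ((Rat.HeightOneSpectrum.primesEquiv (R := 𝓞 ℚ)).symm ⟨3, Fact.out⟩)))
                      (absGaloisRestrict (((Rat.HeightOneSpectrum.primesEquiv (R := 𝓞 ℚ)).symm ⟨3, Fact.out⟩).adicCompletion ℚ) (w₀.1.adicCompletion (CyclotomicField (cycLevel 3 0 r) ℚ))) 1 h) =
                  algebraMap (((Rat.HeightOneSpectrum.primesEquiv (R := 𝓞 ℚ)).symm ⟨3, Fact.out⟩).adicCompletion ℚ) (w₀.1.adicCompletion (CyclotomicField (cycLevel 3 0 r) ℚ)) (expStarOmegaAt d h)) ∧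
                  (∀ (w : ((Rat.HeightOneSpectrum.primesEquiv (R := 𝓞 ℚ)).symm ⟨3, Fact.out⟩).Extension
                    (𝓞 (CyclotomicField (cycLevel 3 0 r) ℚ)))
                  (y : H1 (tateRep W 3) (cycSubgroup 3 0 r))
                  (φ'' : contOneCocycles (subgroupRep (tateRep W 3).toTopRep (cycSubgroup 3 0 r)))
                  (ψT : contOneCocycles ((tateLocalRep W 3 (Sum.inr ((Rat.HeightOneSpectrum.primesEquiv (R := 𝓞 ℚ)).symm ⟨3, Fact.out⟩))).restrict
                    (absGaloisRestrict (((Rat.HeightOneSpectrum.primesEquiv (R := 𝓞 ℚ)).symm ⟨3, Fact.out⟩).adicCompletion ℚ) (w₀.1.adicCompletion (CyclotomicField (cycLevel 3 0 r) ℚ)))).toTopRep),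
                  oneCocycleClass _ φ'' = conjMap (tateRep W 3).toTopRep (cycSubgroup 3 0 r) (g w) 1 y →
                  (∀ σ, ψT.1 σ = φ''.1 ⟨absGaloisRestrictTower ℚ (((Rat.HeightOneSpectrum.primesEquiv (R := 𝓞 ℚ)).symm ⟨3, Fact.out⟩).adicCompletion ℚ) (w₀.1.adicCompletion (CyclotomicField (cycLevel 3 0 r) ℚ)) σ,
                    absGaloisRestrictTower_adicCompletion_mem_cycSubgroup r w₀ σ⟩) →
                  Ψ (Λ 0 r y) w = galAdicCompletionMap
                    (sigma (cycLevel 3 0 r) (modNCyclotomicCharacter ℚ (cycLevel 3 0 r) (g w)))⁻¹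
                    (inv_smul_eq_of_smul_eq (hg w))
                    ((expStarOmegaHom (LocalField.valuation_adicCompletion_natCast_lt_one w₀.1 3 (three_mem_asIdeal_extension _ w₀))
                    ((galRestrictPlace ((Rat.HeightOneSpectrum.primesEquiv (R := 𝓞 ℚ)).symm ⟨3, Fact.out⟩)).comp
                    (absGaloisRestrict (((Rat.HeightOneSpectrum.primesEquiv (R := 𝓞 ℚ)).symm ⟨3, Fact.out⟩).adicCompletion ℚ) (w₀.1.adicCompletion (CyclotomicField (cycLevel 3 0 r) ℚ)))) dw hinjw hexw) (oneCocycleClass _ ψT)))) ∧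
          ∀ (c d a : ℤ) (A : ℕ), 0 < A → Int.gcd c (6 * 3 * A) = 1 → Int.gcd d (6 * 3 * N) = 1 →
            ∃ (z : ∀ (k' : ℕ) (r : (cyclotomicLevelsRat 3 (badPlaces c d A N)).Ideals),
                  H1 (tateRep W 3) ((cyclotomicLevelsRat 3 (badPlaces c d A N)).level k' r.1))
              (x : ∀ (k' : ℕ) (r : (cyclotomicLevelsRat 3 (badPlaces c d A N)).Ideals),
                  CyclotomicField (cycLevel 3 k' r.1) ℚ),
              ZetaBody W 3 P.f ι κK Λ c d a A z x) :
    ∀ (W : WeierstrassCurve ℚ) [W.IsElliptic] [W.IsGloballyMinimal],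
      (∀ m : ℕ, W.HasSurjectiveModNGaloisRep (3 ^ m : ℕ)) →
      W.HasGoodReductionAtPrime 3 →
      Nat.card {Q : (W.baseChange ℚ_[3]).toAffine.Point // (3 : ℕ) • Q = 0} = 1 →
      ∀ (v₃ : HeightOneSpectrum (𝓞 ℚ)), ((3 : ℕ) : 𝓞 ℚ) ∈ v₃.asIdeal →
      ∀ {N : ℕ} [NeZero N] (P : ModularParametrizationData W N), N = W.conductorNorm ℤ →
        (∀ z ∈ P.L.lattice, ∃ w ∈ periodLattice P.f, z = P.c * w) →
        ∀ (t₃ : ℤ), cuspCoeff P.f 3 = t₃ → (3 : ℤ) ∣ 3 + 1 - t₃ →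
        ∀ [ContinuousSMul ℤ_[3] (W.tateModule 3)] [Module.Free ℤ_[3] (W.tateModule 3)]
          [Module.Finite ℤ_[3] (W.tateModule 3)],
        DEFKATOτ⟦W, v₃, N, P, t₃⟧ := by
  intro W _ _ htow hgood ht v₃ hv₃ N _ P hN hlat t₃ ht₃ h3a _ _ _
  -- the row's place IS `v₀ = primesEquiv.symm 3`
  have hv₃eq : v₃ = ((Rat.HeightOneSpectrum.primesEquiv (R := 𝓞 ℚ)).symm ⟨3, Fact.out⟩) := by
    have h3 := primesEquiv_eq_of_natCast_mem Nat.prime_three hv₃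
    have h3' : Rat.HeightOneSpectrum.primesEquiv (R := 𝓞 ℚ) v₃ = ⟨3, Fact.out⟩ := Subtype.ext h3
    rw [← h3', Equiv.symm_apply_apply]
  subst hv₃eq
  haveI : Fact (((3 : ℕ) : 𝓞 ℚ) ∈ ((Rat.HeightOneSpectrum.primesEquiv (R := 𝓞 ℚ)).symm ⟨3, Fact.out⟩).asIdeal) :=
    ⟨(natCast_mem_asIdeal_iff_eq_primesEquiv_symm _ Nat.prime_three).mpr rfl⟩
  letI := valuativeRelPlace ((Rat.HeightOneSpectrum.primesEquiv (R := 𝓞 ℚ)).symm ⟨3, Fact.out⟩)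
  letI := topologicalSpacePlace ((Rat.HeightOneSpectrum.primesEquiv (R := 𝓞 ℚ)).symm ⟨3, Fact.out⟩)
  haveI := isNonarchimedeanLocalField_place ((Rat.HeightOneSpectrum.primesEquiv (R := 𝓞 ℚ)).symm ⟨3, Fact.out⟩)
  haveI := charZero_place ((Rat.HeightOneSpectrum.primesEquiv (R := 𝓞 ℚ)).symm ⟨3, Fact.out⟩)
  letI := padicAlgebraPlace 3 ((Rat.HeightOneSpectrum.primesEquiv (R := 𝓞 ℚ)).symm ⟨3, Fact.out⟩)
  haveI := fact_not_isUnit_place 3 ((Rat.HeightOneSpectrum.primesEquiv (R := 𝓞 ℚ)).symm ⟨3, Fact.out⟩)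
  haveI := isAdicComplete_place 3 ((Rat.HeightOneSpectrum.primesEquiv (R := 𝓞 ℚ)).symm ⟨3, Fact.out⟩)
  obtain ⟨d, hinj, hex, hdual, ι, κK, Λ, hκ0, hunit, hkat, hz⟩ := hKatoV2 W htow P hN hlat
  -- `a₃ = t₃ ≡ 1 (mod 3)`
  have ha : W.frobeniusTrace 3 = t₃ := by
    have h := P.isNewformOf.2 3
    rw [ht₃] at h
    have h' : t₃ = W.LFunction 3 := by exact_mod_cast h
    rw [h', LFunction_apply_prime_eq_frobeniusTrace W 3 hgood]
  have hap : (3 : ℤ) ∣ t₃ - 1 := by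
    obtain ⟨k, hk⟩ := h3a
    exact ⟨1 - k, by linarith⟩
  -- `φ := exp*_ω` at `ℚ₃` in the `ℚ_[3]` currency
  let φ : (tateLocalRep W 3 (Sum.inr ((Rat.HeightOneSpectrum.primesEquiv (R := 𝓞 ℚ)).symm ⟨3, Fact.out⟩))).cohomology 1 →+ ℚ_[3] :=
    expStarOmegaPadicAt d hinj hex
      (((Padic.adicCompletionEquiv (𝓞 ℚ) ⟨3, Fact.out⟩).symm : (((Rat.HeightOneSpectrum.primesEquiv (R := 𝓞 ℚ)).symm ⟨3, Fact.out⟩).adicCompletion ℚ) →+* ℚ_[3]))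
  refine ⟨ι, κK, Λ, φ, hκ0, hunit, hker_of_facts W 3 _ hS d hinj hex _, hdual,
    fun j r w hw Ψ' hΨ' y κ₀ h hres hlocκ => ?_, hz⟩
  -- a TAME level: `3 ∤ m`, `u := w⁻¹ ≡ 3`
  have hpm : ¬ 3 ∣ cycLevel 3 0 r := by
    intro h3
    have hu3 : IsUnit ((3 : ℕ) : ZMod (cycLevel 3 0 r)) := IsUnit.of_mul_eq_one_right _ hw
    rw [ZMod.isUnit_iff_coprime] at hu3
    exact (Nat.Prime.coprime_iff_not_dvd Nat.prime_three).mp hu3 h3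
  have hu : ((w⁻¹ : (ZMod (cycLevel 3 0 r))ˣ) : ZMod (cycLevel 3 0 r)) = ((3 : ℕ) : ZMod (cycLevel 3 0 r)) :=
    Units.inv_eq_of_mul_eq_one_right hw
  have hstw : ∀ 𝔓 : ((Rat.HeightOneSpectrum.primesEquiv (R := 𝓞 ℚ)).symm ⟨3, Fact.out⟩).Extension (𝓞 (CyclotomicField (cycLevel 3 0 r) ℚ)), sigma (cycLevel 3 0 r) w • 𝔓.1 = 𝔓.1 :=
    fun 𝔓 => sigma_smul_eq_self_of_mul_coe_eq_one (cycLevel 3 0 r) 3 hpm w hw 𝔓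
  -- w2-acc4's semi-local algebra `Ψ : ℚ_[3] ⊗ ℚ(ζ_m) ≃ ∏_{w ∣ 3} L_w`
  obtain ⟨Ψ, hΨ⟩ := exists_padicTensorAlgEquiv (CyclotomicField (cycLevel 3 0 r) ℚ) 3
  obtain ⟨w₀, g, hg, dw, hinjw, hexw, hresw, hdefw⟩ := hkat j r Ψ hΨ
  letI := LocalField.charZero_adicCompletion w₀.1
  letI := LocalField.adicCompletionPadicAlgebra w₀.1 3 (three_mem_asIdeal_extension _ w₀)
  haveI : Fact (¬ IsUnit ((3 : ℕ) : integerC (w₀.1.adicCompletion (CyclotomicField (cycLevel 3 0 r) ℚ)))) :=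
    ⟨not_isUnit_natCast_integerC (LocalField.valuation_adicCompletion_natCast_lt_one w₀.1 3 (three_mem_asIdeal_extension _ w₀))⟩
  haveI := isAdicComplete_integerC_natCast (LocalField.valuation_adicCompletion_natCast_lt_one w₀.1 3 (three_mem_asIdeal_extension _ w₀))
  -- the DEFINED `exp*` at `L_{w₀}` and its TWISTED lattice bound
  let φ₀ := expStarOmegaHom (LocalField.valuation_adicCompletion_natCast_lt_one w₀.1 3 (three_mem_asIdeal_extension _ w₀)) ((galRestrictPlace ((Rat.HeightOneSpectrum.primesEquiv (R := 𝓞 ℚ)).symm ⟨3, Fact.out⟩)).comp (absGaloisRestrict (((Rat.HeightOneSpectrum.primesEquiv (R := 𝓞 ℚ)).symm ⟨3, Fact.out⟩).adicCompletion ℚ) (w₀.1.adicCompletion (CyclotomicField (cycLevel 3 0 r) ℚ)))) dw hinjw hexw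
  have htw : ∀ z, ∃ z' ∈ (w₀.1.adicCompletionIntegers (CyclotomicField (cycLevel 3 0 r) ℚ)),
      ((3 : ℕ) : (w₀.1.adicCompletion (CyclotomicField (cycLevel 3 0 r) ℚ))) * φ₀ z = ((3 : ℕ) : (w₀.1.adicCompletion (CyclotomicField (cycLevel 3 0 r) ℚ))) * z' - (t₃ : (w₀.1.adicCompletion (CyclotomicField (cycLevel 3 0 r) ℚ))) * (galAdicCompletionMap (sigma (cycLevel 3 0 r) w) (hstw w₀) z') +
        (galAdicCompletionMap (sigma (cycLevel 3 0 r) w) (hstw w₀) (galAdicCompletionMap (sigma (cycLevel 3 0 r) w) (hstw w₀) z')) := fun z =>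
    exists_prime_mul_expStarOmegaHom_eq_eulerTwistLoc_of_facts (p := 3) le_rfl hT₂ W hgood ha hap ht
      (cycLevel 3 0 r) hpm w⁻¹ w hu hw w₀ d hinj hex hdual dw hinjw hexw hresw z
  -- (RES₀) after the `e₃` round trip: `exp*_{d_w₀} (res h) = algebraMap (e₃ (φ h))`
  have hres₀ : ∀ h : (tateLocalRep W 3 (Sum.inr ((Rat.HeightOneSpectrum.primesEquiv (R := 𝓞 ℚ)).symm ⟨3, Fact.out⟩))).cohomology 1,
      φ₀ (ContinuousRep.cohomologyRes (tateLocalRep W 3 (Sum.inr ((Rat.HeightOneSpectrum.primesEquiv (R := 𝓞 ℚ)).symm ⟨3, Fact.out⟩)))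
        (absGaloisRestrict (((Rat.HeightOneSpectrum.primesEquiv (R := 𝓞 ℚ)).symm ⟨3, Fact.out⟩).adicCompletion ℚ) (w₀.1.adicCompletion (CyclotomicField (cycLevel 3 0 r) ℚ))) 1 h) =
      algebraMap (((Rat.HeightOneSpectrum.primesEquiv (R := 𝓞 ℚ)).symm ⟨3, Fact.out⟩).adicCompletion ℚ) (w₀.1.adicCompletion (CyclotomicField (cycLevel 3 0 r) ℚ)) (Padic.adicCompletionEquiv (𝓞 ℚ) ⟨3, Fact.out⟩ (φ h)) := by
    intro h
    refine (hresw h).trans ?_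
    rw [expStarOmegaPadicAt_apply]
    exact congrArg _ ((Padic.adicCompletionEquiv (𝓞 ℚ) ⟨3, Fact.out⟩).apply_symm_apply _).symm
  -- `Place.Completion (Sum.inr v₀)` is `v₀.adicCompletion ℚ` by `rfl`: read the packet's algebra structure on it
  letI instEF : Algebra (NumberField.Place.Completion (K := ℚ) (Sum.inr ((Rat.HeightOneSpectrum.primesEquiv (R := 𝓞 ℚ)).symm ⟨3, Fact.out⟩))) (w₀.1.adicCompletion (CyclotomicField (cycLevel 3 0 r) ℚ)) :=
    inferInstanceAs (Algebra (((Rat.HeightOneSpectrum.primesEquiv (R := 𝓞 ℚ)).symm ⟨3, Fact.out⟩).adicCompletion ℚ) (w₀.1.adicCompletion (CyclotomicField (cycLevel 3 0 r) ℚ)))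
  -- PER FACTOR `w'`: the twisted COMPAT at `w₀` (w2-acc5), transported along `S = (g̃_{w'}⁻¹)_*`
  have hfac : ∀ w' : ((Rat.HeightOneSpectrum.primesEquiv (R := 𝓞 ℚ)).symm ⟨3, Fact.out⟩).Extension (𝓞 (CyclotomicField (cycLevel 3 0 r) ℚ)),
      ∃ μ : (w'.1.adicCompletion (CyclotomicField (cycLevel 3 0 r) ℚ)),
        (∃ z' ∈ (w'.1.adicCompletionIntegers (CyclotomicField (cycLevel 3 0 r) ℚ)),
          ((3 : ℕ) : (w'.1.adicCompletion (CyclotomicField (cycLevel 3 0 r) ℚ))) * μ = ((3 : ℕ) : (w'.1.adicCompletion (CyclotomicField (cycLevel 3 0 r) ℚ))) * z' - (t₃ : (w'.1.adicCompletion (CyclotomicField (cycLevel 3 0 r) ℚ))) * (galAdicCompletionMap (sigma (cycLevel 3 0 r) w) (hstw w') z') +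
            (galAdicCompletionMap (sigma (cycLevel 3 0 r) w) (hstw w') (galAdicCompletionMap (sigma (cycLevel 3 0 r) w) (hstw w') z'))) ∧
        Ψ ((φ h ⊗ₜ[ℚ] (1 : CyclotomicField (cycLevel 3 0 r) ℚ)) - Λ 0 r y) w' =
          ((3 : ℕ) : (w'.1.adicCompletion (CyclotomicField (cycLevel 3 0 r) ℚ))) ^ (j + 1) * μ := by
    intro w'
    let S : (w₀.1.adicCompletion (CyclotomicField (cycLevel 3 0 r) ℚ)) →+* (w'.1.adicCompletion (CyclotomicField (cycLevel 3 0 r) ℚ)) :=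
      galAdicCompletionMap (sigma (cycLevel 3 0 r) (modNCyclotomicCharacter ℚ (cycLevel 3 0 r) (g w')))⁻¹
        (inv_smul_eq_of_smul_eq (hg w'))
    have hS : ∀ x, S x = galAdicCompletionMap
        (sigma (cycLevel 3 0 r) (modNCyclotomicCharacter ℚ (cycLevel 3 0 r) (g w')))⁻¹
        (inv_smul_eq_of_smul_eq (hg w')) x := fun _ => rfl
    -- `S` commutes with `(σ_w)_*` (abelian Galois group)
    have hcomm : (sigma (cycLevel 3 0 r) (modNCyclotomicCharacter ℚ (cycLevel 3 0 r) (g w')))⁻¹ *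
        sigma (cycLevel 3 0 r) w =
        sigma (cycLevel 3 0 r) w * (sigma (cycLevel 3 0 r) (modNCyclotomicCharacter ℚ (cycLevel 3 0 r) (g w')))⁻¹ :=
      (commute_sigma (cycLevel 3 0 r) _ w).inv_left.eq
    have hSS : ∀ x, S (galAdicCompletionMap (sigma (cycLevel 3 0 r) w) (hstw w₀) x) = (galAdicCompletionMap (sigma (cycLevel 3 0 r) w) (hstw w') (S x)) := fun x => by
      rw [hS, hS, galAdicCompletionMap_galAdicCompletionMap, galAdicCompletionMap_galAdicCompletionMap]
      exact galAdicCompletionMap_congr_left _ hcomm _ _ _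
    -- the `w'`-component of `Λ_{0,r}` READ BACK IN `L_{w₀}`, and `e₃ ∘ φ` in `L_{w₀}`
    let LF : H1 (tateRep W 3) (cycSubgroup 3 0 r) →+ (w₀.1.adicCompletion (CyclotomicField (cycLevel 3 0 r) ℚ)) :=
      (galAdicCompletionMap (sigma (cycLevel 3 0 r) (modNCyclotomicCharacter ℚ (cycLevel 3 0 r) (g w'))) (hg w')).toAddMonoidHom.comp
        ((Pi.evalAddMonoidHom (fun w : ((Rat.HeightOneSpectrum.primesEquiv (R := 𝓞 ℚ)).symm ⟨3, Fact.out⟩).Extension (𝓞 (CyclotomicField (cycLevel 3 0 r) ℚ)) =>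
          w.1.adicCompletion (CyclotomicField (cycLevel 3 0 r) ℚ)) w').comp
        (Ψ.toAddEquiv.toAddMonoidHom.comp (Λ 0 r).toAddMonoidHom))
    let e : (tateLocalRep W 3 (Sum.inr ((Rat.HeightOneSpectrum.primesEquiv (R := 𝓞 ℚ)).symm ⟨3, Fact.out⟩))).cohomology 1 →+ (w₀.1.adicCompletion (CyclotomicField (cycLevel 3 0 r) ℚ)) :=
      ((algebraMap (((Rat.HeightOneSpectrum.primesEquiv (R := 𝓞 ℚ)).symm ⟨3, Fact.out⟩).adicCompletion ℚ) (w₀.1.adicCompletion (CyclotomicField (cycLevel 3 0 r) ℚ))).toAddMonoidHom.comp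
        ((Padic.adicCompletionEquiv (𝓞 ℚ) ⟨3, Fact.out⟩).toRingEquiv.toAddMonoidHom)).comp φ
    have hLF : ∀ y, LF y = galAdicCompletionMap
        (sigma (cycLevel 3 0 r) (modNCyclotomicCharacter ℚ (cycLevel 3 0 r) (g w'))) (hg w') (Ψ (Λ 0 r y) w') :=
      fun y => rfl
    have he : ∀ h, e h = algebraMap (((Rat.HeightOneSpectrum.primesEquiv (R := 𝓞 ℚ)).symm ⟨3, Fact.out⟩).adicCompletion ℚ) (w₀.1.adicCompletion (CyclotomicField (cycLevel 3 0 r) ℚ))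
        (Padic.adicCompletionEquiv (𝓞 ℚ) ⟨3, Fact.out⟩ (φ h)) := fun h => rfl
    obtain ⟨y', hy'⟩ := exists_sub_eq_zsmul_apply_of_factorDef_conjMap W 3 j 0 r ((Rat.HeightOneSpectrum.primesEquiv (R := 𝓞 ℚ)).symm ⟨3, Fact.out⟩)
      (w₀.1.adicCompletion (CyclotomicField (cycLevel 3 0 r) ℚ)) (g w') (absGaloisRestrictTower_adicCompletion_mem_cycSubgroup r w₀) φ₀ LF e
      (fun y φ'' hφ'' ψT hψT => by
        rw [hLF, hdefw w' y φ'' ψT hφ'' hψT, galAdicCompletionMap_apply_inv]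
        rfl)
      (fun h => by rw [he]; exact hres₀ h) Ψ' hΨ' y κ₀ h hres hlocκ
    obtain ⟨z', hz', hz'eq⟩ := htw y'
    refine ⟨S (φ₀ y'), ⟨S z', (galAdicCompletionMap_mem_adicCompletionIntegers_iff _ _ _ z').mpr hz', ?_⟩, ?_⟩
    · -- transport the twisted bound at `w₀` along `S`
      have hT := congrArg S hz'eq
      rw [map_mul, map_natCast, map_add, map_sub, map_mul, map_mul, map_natCast, map_intCast, hSS, hSS, hSS] at hT
      exact hT
    · -- transport `e h − LF y = 3^{j+1} • φ₀ y'` along `S`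
      have hT := congrArg S hy'
      rw [map_sub, map_zsmul, hLF, hS, hS, galAdicCompletionMap_inv_apply, he,
        galAdicCompletionMap_algebraMap_adicCompletion] at hT
      rw [map_sub, Pi.sub_apply, hΨ, map_one, one_mul, hT, zsmul_eq_mul, Int.cast_pow, Int.cast_natCast]
      rfl
  choose μ hμP hμeq using hfac
  choose zf hzO hzeq using hμP
  -- `l := Ψ⁻¹ (z'_w)_w ∈ L_int`, and `Ψ (Tw_{P_w} l)_𝔓 = P_w^loc z'_𝔓 = 3 μ_𝔓`
  haveI := HeightOneSpectrum.Extension.fintype (𝓞 ℚ) ℚ (CyclotomicField (cycLevel 3 0 r) ℚ)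
    (𝓞 (CyclotomicField (cycLevel 3 0 r) ℚ)) ((Rat.HeightOneSpectrum.primesEquiv (R := 𝓞 ℚ)).symm ⟨3, Fact.out⟩)
  refine ⟨Ψ.symm zf, (mem_cycIntLattice_iff_forall_padicTensor_mem (cycLevel 3 0 r) 3 hpm Ψ hΨ _).mpr
    (fun w' => by rw [AlgEquiv.apply_symm_apply]; exact hzO w'), Ψ.injective (funext fun w' => ?_)⟩
  have hPw : Ψ (∑ g : (ZMod (cycLevel 3 0 r))ˣ,
      ((((((3 : ℕ) : MonoidAlgebra ℤ_[3] (ZMod (cycLevel 3 0 r))ˣ)) -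
          MonoidAlgebra.single w (t₃ : ℤ_[3]) +
          MonoidAlgebra.single (w ^ 2) (1 : ℤ_[3])).coeff g : ℤ_[3]) : ℚ_[3]) •
        Algebra.TensorProduct.map (AlgHom.id ℚ ℚ_[3])
          (sigma (cycLevel 3 0 r) g : CyclotomicField (cycLevel 3 0 r) ℚ →ₐ[ℚ]
            CyclotomicField (cycLevel 3 0 r) ℚ) (Ψ.symm zf)) w' =
      ((3 : ℕ) : (w'.1.adicCompletion (CyclotomicField (cycLevel 3 0 r) ℚ))) * Ψ (Ψ.symm zf) w' - (t₃ : (w'.1.adicCompletion (CyclotomicField (cycLevel 3 0 r) ℚ))) * (galAdicCompletionMap (sigma (cycLevel 3 0 r) w) (hstw w') (Ψ (Ψ.symm zf) w')) +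
        (galAdicCompletionMap (sigma (cycLevel 3 0 r) w) (hstw w') (galAdicCompletionMap (sigma (cycLevel 3 0 r) w) (hstw w') (Ψ (Ψ.symm zf) w'))) :=
    padicTensor_eulerTwist_apply (cycLevel 3 0 r) 3
      (Ψ : ℚ_[3] ⊗[ℚ] CyclotomicField (cycLevel 3 0 r) ℚ →ₐ[ℚ] _) hΨ w t₃ w' (hstw w') (Ψ.symm zf)
  rw [show ((3 : ℤ_[3]) ^ (j + 1)) = ((3 ^ (j + 1) : ℕ) : ℤ_[3]) by norm_cast, Nat.cast_smul_eq_nsmul,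
    Nat.cast_smul_eq_nsmul, map_nsmul, map_nsmul, Pi.smul_apply, Pi.smul_apply, hμeq w', hPw,
    AlgEquiv.apply_symm_apply, ← hzeq w', nsmul_eq_mul, nsmul_eq_mul]
  push_cast
  ring

end Summit.BirchSwinnertonDyer.BirchSwinnertonDyer.Theorems.KimAtThreeShallowEqDeepTwistedOfKatoV2

end
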